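import Literature.NumberTheory.LFunctions.RayClassLSeriesFEModulus
import Literature.NumberTheory.LFunctions.ClassGroupLFunctionZeroSymmetry
import HarnessLib

/-!
# Zeros of `L(s, χ)` and `L(1 − s, χ̄)` for primitive ray class characters: the symmetry of the functional
# equation, with multiplicity

Topic `Literature/NumberTheory/LFunctions`; namespace `Literature.NumberTheory.LFunctions`.  Pure-proof
companion of `RayClassLSeriesFEModulus.lean` (Hecke's functional equation transferred to the entire
continuations) and the ray-class analogue of `ClassGroupLFunctionZeroSymmetry.lean` (conductor `1`).
Everything here is PROVED; no definition and no named fact is introduced.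

For a primitive ray class character `χ mod 𝔪 ≠ 0` of sign type `p`, the entire continuation `L` of `L(χ, ·)`
and the entire continuation `L̄` of `L(χ̄, ·)` (`χ̄ = star ψ`), and every NON-INTEGRAL `s`:

* `continuation_eq_mul_continuation_star` — near `s`: `L(z) = u(z) · L̄(1 − z)` with
  `u(z) = W A^{(1−z)/2} A^{−z/2} L_∞(χ, 1 − z) L_∞(χ, z)⁻¹` analytic and non-zero at `s`
  (`A = |d_K| 𝔑𝔪`; Neukirch VII (8.6));
* `analyticOrderAt_continuation_eq` — **`ord_s L = ord_{1−s} L̄`**;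
* `continuation_eq_zero_iff` — `L(s) = 0 ↔ L̄(1 − s) = 0`.

These give the reflection `ρ ↦ 1 − ρ̄`-free form `ρ ↦ 1 − ρ` between the zeros of `L(·, χ)` with `β < 1/2`
and the zeros of `L(·, χ̄)` with `β > 1/2` used to count zeros in windows (Montgomery–Vaughan Lemma 12.8
over `K`, with conductor).

## References

* J. Neukirch, *Algebraic Number Theory*, Grundlehren 322, Springer 1999, Ch. VII §8 (8.6) Corollary. [NeukirchANT1999]
* H. L. Montgomery, R. C. Vaughan, *Multiplicative Number Theory I*, CUP 2007, §10.2 (Cor. 10.8), Lemma 12.8.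
  [MontgomeryVaughan2007]
-/

noncomputable section

open Complex NumberField NumberField.InfinitePlace NumberField.Units IsDedekindDomain Filter Topology Set Metric
open scoped NumberField nonZeroDivisors
open scoped Classical

namespace Literature.NumberTheory.LFunctions

variable {K : Type*} [Field K] [NumberField K]
variable {𝔪 : Ideal (𝓞 K)} {ψ : HeightOneSpectrum (𝓞 K) → ℂ} {p : Finset {w : InfinitePlace K // IsReal w}}

/-! ### The Gamma factor off the integers -/

omit [NumberField K] in
/-- At a non-integer `s`, no argument `e_w s/2 + p_w/2` of the Gamma factor is a pole. [folklore] -/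
private theorem gammaArg_ne_neg_nat (p : Finset {w : InfinitePlace K // IsReal w}) {s : ℂ} (hs : ∀ n : ℤ, s ≠ n)
    (w : InfinitePlace K) (m : ℕ) : (mult w : ℂ) * (s / 2) + (NumberField.halfWeight K p w : ℂ) ≠ -m := by
  intro h
  by_cases hw : IsReal w
  · have h1 : mult w = 1 := by simp [mult, hw]
    have hh : NumberField.halfWeight K p w = 0 ∨ NumberField.halfWeight K p w = 1 / 2 := by
      unfold NumberField.halfWeight; rw [dif_pos hw]; split_ifs <;> simp
    rw [h1] at h
    rcases hh with h2 | h2 <;> rw [h2] at h <;> push_cast at h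
    · exact hs (-(2 * m)) (by push_cast; linear_combination 2 * h)
    · exact hs (-(2 * m) - 1) (by push_cast; linear_combination 2 * h)
  · have h1 : mult w = 2 := by simp [mult, hw]
    have h2 : NumberField.halfWeight K p w = 0 := by unfold NumberField.halfWeight; rw [dif_neg hw]
    rw [h1, h2] at h
    push_cast at h
    exact hs (-m) (by push_cast; linear_combination h)

/-- `A_p` is differentiable at every `z` none of whose Gamma arguments is a pole. [folklore] -/
private theorem differentiableAt_gammaFactorCP_of_ne (p : Finset {w : InfinitePlace K // IsReal w}) {z : ℂ}
    (hz : ∀ (w : InfinitePlace K) (m : ℕ), (mult w : ℂ) * z + (NumberField.halfWeight K p w : ℂ) ≠ -m) :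
    DifferentiableAt ℂ (NumberField.gammaFactorCP K p) z := by
  set F : InfinitePlace K → ℂ → ℂ := fun w z ↦ (((1 / (Real.pi * mult w) : ℝ)) : ℂ) ^
      ((mult w : ℂ) * z + (NumberField.halfWeight K p w : ℂ)) *
    Complex.Gamma ((mult w : ℂ) * z + (NumberField.halfWeight K p w : ℂ)) with hF
  have hd : ∀ w ∈ (Finset.univ : Finset (InfinitePlace K)), DifferentiableAt ℂ (F w) z := by
    intro w _
    have hlin : DifferentiableAt ℂ (fun z : ℂ ↦ (mult w : ℂ) * z + (NumberField.halfWeight K p w : ℂ)) z :=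
      (differentiableAt_id.const_mul _).add_const _
    have hb : (((1 / (Real.pi * mult w) : ℝ)) : ℂ) ≠ 0 := by
      have : (0 : ℝ) < mult w := Nat.cast_pos.mpr mult_pos
      exact Complex.ofReal_ne_zero.mpr (by positivity)
    refine DifferentiableAt.mul ?_ ?_
    · exact DifferentiableAt.const_cpow hlin (Or.inl hb)
    · exact (Complex.differentiableAt_Gamma _ fun m h ↦ hz w m h).comp z hlin
  have key := DifferentiableAt.finsetProd hd
  have heq : (∏ w ∈ (Finset.univ : Finset (InfinitePlace K)), F w) = NumberField.gammaFactorCP K p := by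
    funext z
    rw [Finset.prod_apply z Finset.univ F, NumberField.gammaFactorCP]
  rw [heq] at key
  exact key

variable (K) in
/-- **`L_∞(χ, ·)` is analytic at every non-integer.** [folklore] -/
private theorem analyticAt_rayClassGammaFactor (p : Finset {w : InfinitePlace K // IsReal w}) {s : ℂ}
    (hs : ∀ n : ℤ, s ≠ n) : AnalyticAt ℂ (rayClassGammaFactor K p) s := by
  have hopen : IsOpen {z : ℂ | ∀ n : ℤ, z ≠ n} := NumberField.isOpen_compl_int
  have hdiff : DifferentiableOn ℂ (rayClassGammaFactor K p) {z : ℂ | ∀ n : ℤ, z ≠ n} := by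
    intro z hz
    refine DifferentiableAt.differentiableWithinAt ?_
    have heq : rayClassGammaFactor K p = fun z ↦ (2 : ℂ) ^ nrComplexPlaces K * NumberField.gammaFactorCP K p (z / 2) := by
      funext z; exact rayClassGammaFactor_eq p z
    rw [heq]
    refine DifferentiableAt.const_mul ?_ _
    -- `A_p` is differentiable at `z/2` since no Gamma argument is a pole
    have hG : DifferentiableAt ℂ (NumberField.gammaFactorCP K p) (z / 2) :=
      differentiableAt_gammaFactorCP_of_ne p fun w m ↦ gammaArg_ne_neg_nat p hz w m
    have hhalf : DifferentiableAt ℂ (fun y : ℂ ↦ y / 2) z := differentiableAt_id.div_const 2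
    have hc := DifferentiableAt.comp (𝕜 := ℂ) z hG hhalf
    simpa [Function.comp_def] using hc
  exact hdiff.analyticAt (hopen.mem_nhds hs)

/-- `L_∞(χ, s) ≠ 0` at every non-integer `s`. [folklore] -/
private theorem rayClassGammaFactor_ne_zero_of_ne_int (p : Finset {w : InfinitePlace K // IsReal w}) {s : ℂ}
    (hs : ∀ n : ℤ, s ≠ n) : rayClassGammaFactor K p s ≠ 0 := by
  rw [rayClassGammaFactor_eq]
  refine mul_ne_zero (pow_ne_zero _ two_ne_zero) ?_
  unfold NumberField.gammaFactorCP
  refine Finset.prod_ne_zero_iff.mpr fun w _ ↦ mul_ne_zero ?_ ?_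
  · rw [Ne, cpow_eq_zero_iff, not_and_or]
    have : (0 : ℝ) < mult w := Nat.cast_pos.mpr mult_pos
    exact Or.inl (Complex.ofReal_ne_zero.mpr (by positivity))
  · exact Complex.Gamma_ne_zero (gammaArg_ne_neg_nat p hs w)

/-! ### The functional equation between the two continuations -/

/-- **`Λ'(w) = A^{w/2} L_∞(χ, w) L̄(w)` off the integers**, for the continuation `Λ'` of `Λ(χ̄, ·)` from Hecke's
functional equation and any entire continuation `L̄` of `L(χ̄, ·)` (identity theorem on `ℂ ∖ ℤ`). [folklore] -/
private theorem completed_eq_of_ne_int (h𝔪 : 𝔪 ≠ ⊥) {Λ' L' : ℂ → ℂ} (hΛ'd : DifferentiableOn ℂ Λ' ({0, 1}ᶜ : Set ℂ))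
    (hΛ' : ∀ s : ℂ, 1 < s.re → Λ' s = completedRayClassL K 𝔪 (star ψ) p s)
    (hL' : Differentiable ℂ L') (hL's : ∀ s : ℂ, 1 < s.re → L' s = rayClassLSeries 𝔪 (star ψ) s)
    {w : ℂ} (hw : ∀ n : ℤ, w ≠ n) :
    Λ' w = (((|(discr K : ℝ)| * (Ideal.absNorm 𝔪 : ℝ) : ℝ)) : ℂ) ^ (w / 2) * rayClassGammaFactor K p w * L' w := by
  set V : Set ℂ := {z : ℂ | ∀ n : ℤ, z ≠ n} with hV
  have hVo : IsOpen V := NumberField.isOpen_compl_int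
  have hVeq : V = (Set.range (fun n : ℤ ↦ (n : ℂ)))ᶜ := by
    ext z; simp only [hV, Set.mem_setOf_eq, Set.mem_compl_iff, Set.mem_range, not_exists]
    exact ⟨fun h n hn ↦ h n hn.symm, fun h n hn ↦ h n hn.symm⟩
  have hVc : IsPreconnected V := by
    rw [hVeq]
    exact ((Set.countable_range _).isPathConnected_compl_of_one_lt_rank
      (Complex.rank_real_complex ▸ Nat.one_lt_ofNat)).isConnected.isPreconnected
  have hVsub : V ⊆ ({0, 1}ᶜ : Set ℂ) := by
    intro z hz h01
    rcases h01 with h | h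
    · exact hz 0 (by simpa using h)
    · exact hz 1 (by simpa using h)
  have hA0 : ((((|(discr K : ℝ)| * (Ideal.absNorm 𝔪 : ℝ) : ℝ)) : ℂ)) ≠ 0 := by
    have hd : 0 < |(discr K : ℝ)| := abs_pos.mpr (by exact_mod_cast discr_ne_zero K)
    have hm : (0 : ℝ) < Ideal.absNorm 𝔪 := by
      exact_mod_cast Nat.pos_of_ne_zero (by rwa [ne_eq, Ideal.absNorm_eq_zero_iff])
    exact Complex.ofReal_ne_zero.mpr (by positivity)
  set F : ℂ → ℂ := fun z ↦ (((|(discr K : ℝ)| * (Ideal.absNorm 𝔪 : ℝ) : ℝ)) : ℂ) ^ (z / 2) *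
    rayClassGammaFactor K p z * L' z with hF
  have hFa : AnalyticOnNhd ℂ F V := by
    intro z hz
    refine ((AnalyticAt.mul ?_ (analyticAt_rayClassGammaFactor K p hz)).mul
      ((hL'.differentiableOn.analyticOnNhd isOpen_univ) z (Set.mem_univ _)))
    refine (DifferentiableOn.analyticAt (s := Set.univ) ?_ Filter.univ_mem)
    intro y _
    exact ((differentiableAt_id.div_const 2).const_cpow (Or.inl hA0)).differentiableWithinAt
  have hΛa : AnalyticOnNhd ℂ Λ' V := (hΛ'd.mono hVsub).analyticOnNhd hVo
  have h32 : ((3 / 2 : ℝ) : ℂ) ∈ V := by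
    intro n hn
    have := congrArg Complex.re hn
    simp at this
    have h2 : (2 * n : ℤ) = 3 := by exact_mod_cast (by linarith : (2 * n : ℝ) = 3)
    omega
  have heq := AnalyticOnNhd.eqOn_of_preconnected_of_eventuallyEq hΛa hFa hVc h32 ?_
  · exact heq hw
  · refine eventually_of_mem ((continuous_re.isOpen_preimage _ isOpen_Ioi).mem_nhds
      (by rw [Set.mem_preimage, Complex.ofReal_re]; norm_num)) fun z (hz : 1 < z.re) ↦ ?_
    show Λ' z = F z
    rw [hF]
    dsimp only
    rw [hΛ' z hz, completedRayClassL, hL's z hz]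

/-- **The functional equation between the entire continuations, near a non-integer**: there is a function `u`,
analytic and non-zero at `s`, with `L(z) = u(z) · L̄(1 − z)` for `z` near `s`.
[cite: NeukirchANT1999, Ch. VII §8 (8.6) Corollary] -/
theorem continuation_eq_mul_continuation_star (hψ : IsRayClassCharacter 𝔪 ψ) (hprim : IsPrimitive 𝔪 ψ)
    (hp : IsSignType 𝔪 ψ p) (h𝔪 : 𝔪 ≠ ⊥) {L L' : ℂ → ℂ} (hL : Differentiable ℂ L)
    (hLs : ∀ s : ℂ, 1 < s.re → L s = rayClassLSeries 𝔪 ψ s) (hL' : Differentiable ℂ L')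
    (hL's : ∀ s : ℂ, 1 < s.re → L' s = rayClassLSeries 𝔪 (star ψ) s) {s : ℂ} (hs : ∀ n : ℤ, s ≠ n) :
    ∃ u : ℂ → ℂ, AnalyticAt ℂ u s ∧ u s ≠ 0 ∧ (fun z ↦ L z) =ᶠ[𝓝 s] fun z ↦ u z * L' (1 - z) := by
  obtain ⟨W, Λ, Λ', hW, -, -, hΛd, hΛ'd, hΛ, hΛ', hfe⟩ := rayClassLSeries_functional_equation' hψ hprim hp h𝔪
  -- `L = W Λ'(1 - ·) γ⁻¹ A^{-·/2}` off `{0,1}` (as in `continuation_eq_of_ne`, re-derived to keep `Λ'` in hand)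
  set A : ℝ := |(discr K : ℝ)| * (Ideal.absNorm 𝔪 : ℝ) with hA
  have hApos : 0 < A := by
    have hd : 0 < |(discr K : ℝ)| := abs_pos.mpr (by exact_mod_cast discr_ne_zero K)
    have hm : (0 : ℝ) < Ideal.absNorm 𝔪 := by
      exact_mod_cast Nat.pos_of_ne_zero (by rwa [ne_eq, Ideal.absNorm_eq_zero_iff])
    positivity
  have hA0 : ((A : ℝ) : ℂ) ≠ 0 := Complex.ofReal_ne_zero.mpr hApos.ne'
  have hW0 : W ≠ 0 := fun h ↦ by rw [h, norm_zero] at hW; exact zero_ne_one hW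
  -- the factor `u`
  set u : ℂ → ℂ := fun z ↦ W * (((A : ℝ) : ℂ) ^ ((1 - z) / 2) * rayClassGammaFactor K p (1 - z)) *
    ((rayClassGammaFactor K p z)⁻¹ * (((A : ℝ) : ℂ) ^ (z / 2))⁻¹) with hu
  have hs1 : ∀ n : ℤ, 1 - s ≠ n := NumberField.one_sub_ne_int hs
  have hua : AnalyticAt ℂ u s := by
    have h1 : AnalyticAt ℂ (fun z : ℂ ↦ ((A : ℝ) : ℂ) ^ ((1 - z) / 2)) s := by
      refine DifferentiableOn.analyticAt (s := Set.univ) (fun y _ ↦ ?_) Filter.univ_mem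
      exact (((differentiableAt_const _).sub differentiableAt_id).div_const 2).const_cpow (Or.inl hA0)
        |>.differentiableWithinAt
    have h2 : AnalyticAt ℂ (fun z : ℂ ↦ rayClassGammaFactor K p (1 - z)) s :=
      (analyticAt_rayClassGammaFactor K p hs1).comp_of_eq (analyticAt_const.sub analyticAt_id) rfl
    have h3 : AnalyticAt ℂ (fun z : ℂ ↦ (rayClassGammaFactor K p z)⁻¹) s :=
      (analyticAt_rayClassGammaFactor K p hs).inv (rayClassGammaFactor_ne_zero_of_ne_int p hs)
    have h4 : AnalyticAt ℂ (fun z : ℂ ↦ (((A : ℝ) : ℂ) ^ (z / 2))⁻¹) s := by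
      refine (DifferentiableOn.analyticAt (s := Set.univ) (fun y _ ↦ ?_) Filter.univ_mem).inv ?_
      · exact ((differentiableAt_id.div_const 2).const_cpow (Or.inl hA0)).differentiableWithinAt
      · rw [Ne, cpow_eq_zero_iff, not_and_or]; exact Or.inl hA0
    exact (analyticAt_const.mul (h1.mul h2)).mul (h3.mul h4)
  have hus : u s ≠ 0 := by
    have hc1 : ((A : ℝ) : ℂ) ^ ((1 - s) / 2) ≠ 0 := by rw [Ne, cpow_eq_zero_iff, not_and_or]; exact Or.inl hA0
    have hc2 : ((A : ℝ) : ℂ) ^ (s / 2) ≠ 0 := by rw [Ne, cpow_eq_zero_iff, not_and_or]; exact Or.inl hA0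
    have hγ1 := rayClassGammaFactor_ne_zero_of_ne_int p hs1
    have hγ := rayClassGammaFactor_ne_zero_of_ne_int p hs
    simp only [hu]
    exact mul_ne_zero (mul_ne_zero hW0 (mul_ne_zero hc1 hγ1)) (mul_ne_zero (inv_ne_zero hγ) (inv_ne_zero hc2))
  refine ⟨u, hua, hus, ?_⟩
  -- Step 1: `L = Λ · L_∞⁻¹ · A^{-·/2}` on `ℂ ∖ {0,1}` (identity theorem, as in `continuation_eq_of_ne`)
  set F : ℂ → ℂ := fun z ↦ Λ z * ((rayClassGammaFactor K p z)⁻¹ * (((A : ℝ) : ℂ) ^ (z / 2))⁻¹) with hF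
  have hU : IsOpen (({0, 1} : Set ℂ)ᶜ) := (Set.toFinite _).isClosed.isOpen_compl
  have hpc : IsPreconnected (({0, 1} : Set ℂ)ᶜ) :=
    ((Set.toFinite ({0, 1} : Set ℂ)).countable.isPathConnected_compl_of_one_lt_rank
      (Complex.rank_real_complex ▸ Nat.one_lt_ofNat)).isConnected.isPreconnected
  have hcpow : Differentiable ℂ fun z : ℂ ↦ (((A : ℝ) : ℂ) ^ (z / 2))⁻¹ := by
    have : (fun z : ℂ ↦ (((A : ℝ) : ℂ) ^ (z / 2))⁻¹) = fun z ↦ ((A : ℝ) : ℂ) ^ (-(z / 2)) := by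
      funext z; rw [Complex.cpow_neg]
    rw [this]
    exact differentiable_id.div_const 2 |>.neg.const_cpow (Or.inl hA0)
  have hγinv : Differentiable ℂ fun z : ℂ ↦ (rayClassGammaFactor K p z)⁻¹ := by
    have heq : (fun z : ℂ ↦ (rayClassGammaFactor K p z)⁻¹) =
        fun z ↦ ((2 : ℂ) ^ nrComplexPlaces K)⁻¹ * (NumberField.gammaFactorCP K p (z / 2))⁻¹ := by
      funext z; rw [rayClassGammaFactor_eq, mul_inv]
    rw [heq]
    exact (differentiable_const _).mul
      ((NumberField.differentiable_inv_gammaFactorCP p).comp (differentiable_id.div_const 2))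
  have hFd : DifferentiableOn ℂ F (({0, 1} : Set ℂ)ᶜ) := hΛd.mul ((hγinv.mul hcpow).differentiableOn)
  have hne2 : (2 : ℂ) ∈ (({0, 1} : Set ℂ)ᶜ) := by norm_num
  have heq : EqOn L F (({0, 1} : Set ℂ)ᶜ) := by
    refine AnalyticOnNhd.eqOn_of_preconnected_of_eventuallyEq (𝕜 := ℂ) (hL.differentiableOn.analyticOnNhd hU)
      (hFd.analyticOnNhd hU) hpc hne2 ?_
    refine eventually_of_mem ((continuous_re.isOpen_preimage _ isOpen_Ioi).mem_nhds (by simp : 1 < (2 : ℂ).re))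
      fun t (ht : 1 < t.re) ↦ ?_
    have hγ0 : rayClassGammaFactor K p t ≠ 0 := by
      rw [rayClassGammaFactor_eq]
      refine mul_ne_zero (pow_ne_zero _ two_ne_zero) (NumberField.gammaFactorCP_ne_zero p ?_)
      simp only [Complex.div_ofNat_re]; linarith
    have hc0 : ((A : ℝ) : ℂ) ^ (t / 2) ≠ 0 := by
      rw [Ne, cpow_eq_zero_iff, not_and_or]; exact Or.inl hA0
    rw [hF]
    dsimp only
    rw [hΛ t ht, completedRayClassL, ← hA, hLs t ht]
    field_simp
  -- Step 2: near `s` every point is a non-integer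
  have hopen : IsOpen {z : ℂ | ∀ n : ℤ, z ≠ n} := NumberField.isOpen_compl_int
  filter_upwards [hopen.mem_nhds hs] with z hz
  have hz0 : z ≠ 0 := fun h ↦ hz 0 (by simpa using h)
  have hz1 : z ≠ 1 := fun h ↦ hz 1 (by simpa using h)
  have hzU : z ∈ (({0, 1} : Set ℂ)ᶜ) := by simp [hz0, hz1]
  have hz1' : ∀ n : ℤ, 1 - z ≠ n := NumberField.one_sub_ne_int hz
  have hΛz : Λ z = W * Λ' (1 - z) := by simpa using hfe (1 - z)
  have hΛ'z := completed_eq_of_ne_int (K := K) (𝔪 := 𝔪) (ψ := ψ) (p := p) h𝔪 hΛ'd hΛ' hL' hL's hz1'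
  rw [heq hzU, hF]
  dsimp only
  rw [hΛz, hΛ'z, hu, ← hA]
  ring

/-- **The symmetry of the zeros, with multiplicity**: for `s ∉ ℤ`, `ord_s L = ord_{1−s} L̄`.
[cite: MontgomeryVaughan2007, §10.2 (Corollary 10.8 analogue)] -/
theorem analyticOrderAt_continuation_eq (hψ : IsRayClassCharacter 𝔪 ψ) (hprim : IsPrimitive 𝔪 ψ)
    (hp : IsSignType 𝔪 ψ p) (h𝔪 : 𝔪 ≠ ⊥) {L L' : ℂ → ℂ} (hL : Differentiable ℂ L)
    (hLs : ∀ s : ℂ, 1 < s.re → L s = rayClassLSeries 𝔪 ψ s) (hL' : Differentiable ℂ L')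
    (hL's : ∀ s : ℂ, 1 < s.re → L' s = rayClassLSeries 𝔪 (star ψ) s) {s : ℂ} (hs : ∀ n : ℤ, s ≠ n) :
    analyticOrderAt L s = analyticOrderAt L' (1 - s) := by
  obtain ⟨u, hua, hus, hLu⟩ := continuation_eq_mul_continuation_star hψ hprim hp h𝔪 hL hLs hL' hL's hs
  have hL'a : AnalyticAt ℂ (fun z ↦ L' (1 - z)) s :=
    ((hL'.differentiableOn.analyticOnNhd isOpen_univ) (1 - s) (Set.mem_univ _)).comp_of_eq
      (analyticAt_const.sub analyticAt_id) rfl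
  rw [analyticOrderAt_congr hLu, NumberField.analyticOrderAt_mul_of_ne_zero hua hus hL'a,
    NumberField.analyticOrderAt_comp_one_sub]

/-- `L(s) = 0 ↔ L̄(1 − s) = 0` for `s ∉ ℤ`. [cite: MontgomeryVaughan2007, §10.2] -/
theorem continuation_eq_zero_iff (hψ : IsRayClassCharacter 𝔪 ψ) (hprim : IsPrimitive 𝔪 ψ)
    (hp : IsSignType 𝔪 ψ p) (h𝔪 : 𝔪 ≠ ⊥) {L L' : ℂ → ℂ} (hL : Differentiable ℂ L)
    (hLs : ∀ s : ℂ, 1 < s.re → L s = rayClassLSeries 𝔪 ψ s) (hL' : Differentiable ℂ L')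
    (hL's : ∀ s : ℂ, 1 < s.re → L' s = rayClassLSeries 𝔪 (star ψ) s) {s : ℂ} (hs : ∀ n : ℤ, s ≠ n) :
    L s = 0 ↔ L' (1 - s) = 0 := by
  have hLa : AnalyticAt ℂ L s := (hL.differentiableOn.analyticOnNhd isOpen_univ) s (Set.mem_univ _)
  have hL'a : AnalyticAt ℂ L' (1 - s) := (hL'.differentiableOn.analyticOnNhd isOpen_univ) (1 - s) (Set.mem_univ _)
  have h := analyticOrderAt_continuation_eq hψ hprim hp h𝔪 hL hLs hL' hL's hs
  constructor
  · intro h0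
    by_contra h1
    have h2 : analyticOrderAt L' (1 - s) = 0 := hL'a.analyticOrderAt_eq_zero.mpr h1
    rw [h2] at h
    exact (hLa.analyticOrderAt_eq_zero.mp h) h0
  · intro h0
    by_contra h1
    have h2 : analyticOrderAt L s = 0 := hLa.analyticOrderAt_eq_zero.mpr h1
    rw [h2] at h
    exact (hL'a.analyticOrderAt_eq_zero.mp h.symm) h0

end Literature.NumberTheory.LFunctions
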